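import Literature.Probability.RandomPlanarGeometry.DrivingFunctionMeasurable
import Literature.Probability.RandomPlanarGeometry.SLETraceKappaLimit
import Literature.Probability.RandomPlanarGeometry.SLERestrictionMartingale
import Literature.Probability.RandomPlanarGeometry.LoewnerTransformContinuity
import Literature.Probability.RandomPlanarGeometry.LoewnerGrowth
import Literature.Probability.RandomPlanarGeometry.LoewnerHullConnected
import Literature.Probability.RandomPlanarGeometry.LocalMartingaleProofs
import Literature.Probability.RandomPlanarGeometry.LoewnerDescription
import Mathlib.MeasureTheory.Constructions.BorelSpace.Metric
import Mathlib.Topology.MetricSpace.Closeds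
import HarnessLib

/-!
# `stub_rangeBound_aux1` — helper file of `stub_rangeBound` (crux `PathUpgradeR`,
stmt-CriticalPhenomena-18055, route `SAWReversalUpgrade`, line `bidir_windows`)

Landing target:
`Summits/CriticalPhenomena/SAWScalingLimit/Theorems/SAWReversalUpgradePathUpgradeRRangeBoundAux.lean`
(`--supports stmt-CriticalPhenomena-18055`; registered helper stub `stub_rangeBound_aux1`).

The registered theorem `stub_rangeBound_aux1` is the range identity of step (0) of the proof of
`stub_rangeBound`: the range of the time-compactified image `c` of a half-infinite curve `γ` under
`Φ` with endpoint `b` (`IsCompactifiedImage Φ γ b c`) is `insert b (Φ '' range γ)`.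

The sub-namespace `PathUpgradeRRangeBound` collects the deterministic and measure-theoretic
lemmas consumed by `stub_rangeBound` (file `SAWReversalUpgradePathUpgradeRRangeBound.lean`):

* two Hausdorff estimates (`hausdorffDist_range_image_le`: SLE side, range vs. initial arc under a
  tail bound; `hausdorffDist_image_Icc_range_le`: lattice side, initial arc vs. range);
* the SLE-side deterministic core `mem_cthickening_of_mem_closure` (a driver in the closure of the
  bad driver set, continuity of `W ↦ φ̄ (closure K_T(W))` at it, and the tail bound put the range
  of the compactified image in the closed `5ε`-thickening of `F` in `NonemptyCompacts ℂ`);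
* the lattice-side deterministic core `lattice_hausdorffDist_le` (dictionary + no H7 window
  ⟹ `d_H (φ̄ (closure K_T(W)), range X) ≤ 2ε`);
* `exists_measure_cthickening_le` (`tendsto_measure_cthickening_of_isClosed` on an image measure),
  `exists_measure_tail_le` (the SLE tail event is small, continuity from above along a countable
  dense set of times) and `measure_sleDriving_apply_eq_zero` (`P' {√κ B_T = 0} = 0`, the Gaussian
  law of `B_T` has no atom).
-/

noncomputable section

open scoped ENNReal NNReal Topology unitInterval
open MeasureTheory Filter Set Metric TopologicalSpace
open Literature.Probability Literature.Probability.RandomPlanarGeometry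
open UpperHalfPlane (upperHalfPlaneSet)

namespace Summit.CriticalPhenomena.SAWScalingLimit.Theorems

/-- **Range of a compactified image** (registered helper `stub_rangeBound_aux1` of
`stub_rangeBound`): the range of the time-compactified image `c` of `γ` under `Φ` with endpoint
`b` is `Φ '' range γ` together with `b` (`rayParam` maps `[0, 1)` onto `[0, ∞)`). [folklore] -/
theorem stub_rangeBound_aux1 : ∀ {Φ : ℂ → ℂ} {γ : NNReal → ℂ} {b : ℂ} {c : Literature.Probability.RandomPlanarGeometry.Curve ℂ}, Literature.Probability.RandomPlanarGeometry.IsCompactifiedImage Φ γ b c → c.range = insert b (Φ '' Set.range γ) := by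
  intro Φ γ b c h
  ext x
  rw [Curve.mem_range]
  constructor
  · rintro ⟨s, rfl⟩
    by_cases hs : (s : ℝ) < 1
    · exact Or.inr ⟨γ (rayParam s), mem_range_self _, (h.1 s hs).symm⟩
    · obtain rfl : s = 1 := Subtype.ext (le_antisymm s.2.2 (not_lt.1 hs))
      exact Or.inl h.2
  · rintro (rfl | ⟨_, ⟨t, rfl⟩, rfl⟩)
    · exact ⟨1, h.2⟩
    · obtain ⟨s, hs, rfl⟩ := exists_rayParam_eq t
      exact ⟨s, h.1 s hs⟩

namespace PathUpgradeRRangeBound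

/-! ### Two Hausdorff estimates -/

/-- SLE side: if every tail point `Φ (γ t)`, `t ≥ T`, is within `ε` of the endpoint `b`, then the
range of the compactified image is within Hausdorff distance `2ε` of the initial arc
`Φ (γ [0, T])`. [folklore] -/
theorem hausdorffDist_range_image_le {Φ : ℂ → ℂ} {γ : ℝ≥0 → ℂ} {b : ℂ} {c : Curve ℂ}
    (h : IsCompactifiedImage Φ γ b c) {T : ℝ≥0} {ε : ℝ} (hε : 0 ≤ ε)
    (htail : ∀ t : ℝ≥0, T ≤ t → dist (Φ (γ t)) b ≤ ε) :
    hausdorffDist c.range (Φ '' (γ '' Icc 0 T)) ≤ 2 * ε := by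
  have hT : Φ (γ T) ∈ Φ '' (γ '' Icc 0 T) := ⟨γ T, ⟨T, ⟨zero_le, le_rfl⟩, rfl⟩, rfl⟩
  have hTb : dist b (Φ (γ T)) ≤ ε := by rw [dist_comm]; exact htail T le_rfl
  refine hausdorffDist_le_of_mem_dist (by positivity) ?_ ?_
  · intro x hx
    rw [stub_rangeBound_aux1 h] at hx
    rcases hx with rfl | ⟨_, ⟨t, rfl⟩, rfl⟩
    · exact ⟨_, hT, by linarith⟩
    · rcases le_or_gt t T with htT | hTt
      · exact ⟨_, ⟨γ t, ⟨t, ⟨zero_le, htT⟩, rfl⟩, rfl⟩, by rw [dist_self]; positivity⟩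
      · refine ⟨_, hT, ?_⟩
        calc dist (Φ (γ t)) (Φ (γ T)) ≤ dist (Φ (γ t)) b + dist b (Φ (γ T)) :=
              dist_triangle _ _ _
          _ ≤ ε + ε := add_le_add (htail t hTt.le) hTb
          _ = 2 * ε := by ring
  · rintro _ ⟨_, ⟨t, -, rfl⟩, rfl⟩
    refine ⟨Φ (γ t), ?_, by rw [dist_self]; positivity⟩
    rw [stub_rangeBound_aux1 h]
    exact Or.inr ⟨γ t, mem_range_self _, rfl⟩

/-- Lattice side: if every point `X t`, `t ≥ u₀`, is within `ε` of `b`, then the initial arc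
`X [0, u₀]` is within Hausdorff distance `2ε` of the whole range of `X`. [folklore] -/
theorem hausdorffDist_image_Icc_range_le (X : Curve ℂ) (u₀ : I) {b : ℂ} {ε : ℝ} (hε : 0 ≤ ε)
    (htail : ∀ t : I, u₀ ≤ t → dist (X t) b < ε) :
    hausdorffDist (X '' Icc 0 u₀) X.range ≤ 2 * ε := by
  refine hausdorffDist_le_of_mem_dist (by positivity) ?_ ?_
  · rintro _ ⟨t, -, rfl⟩
    exact ⟨X t, ⟨t, rfl⟩, by rw [dist_self]; positivity⟩
  · rintro _ ⟨t, rfl⟩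
    rcases le_or_gt t u₀ with ht | ht
    · exact ⟨X t, ⟨t, ⟨unitInterval.nonneg', ht⟩, rfl⟩, by rw [dist_self]; positivity⟩
    · refine ⟨X u₀, ⟨u₀, ⟨unitInterval.nonneg', le_rfl⟩, rfl⟩, ?_⟩
      calc dist (X t) (X u₀) ≤ dist (X t) b + dist b (X u₀) := dist_triangle _ _ _
        _ ≤ ε + ε := add_le_add (htail t ht.le).le
            (by rw [dist_comm]; exact (htail u₀ le_rfl).le)
        _ = 2 * ε := by ring

/-! ### Compactness bookkeeping for the triangle inequality -/

/-- The boundary extension maps compact subsets of the closed half-plane to bounded sets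
(Carathéodory continuity on `{0 ≤ im}`). [folklore] -/
theorem isBounded_image_boundaryExtension {D : DobrushinDomain}
    (φ : ConformalEquiv upperHalfPlaneSet D.carrier) {K : Set ℂ} (hK : IsCompact K)
    (hKH : K ⊆ {z : ℂ | 0 ≤ z.im}) : Bornology.IsBounded (φ.boundaryExtension '' K) :=
  (hK.image_of_continuousOn ((continuousOn_boundaryExtension_im_nonneg φ).mono hKH)).isBounded

/-- The closure of a Loewner hull is a compact subset of the closed half-plane. [folklore] -/
theorem isCompact_closure_hull {W : ℝ≥0 → ℝ} (hW : Continuous W) (T : ℝ≥0) :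
    IsCompact (closure (Loewner.hull W T)) ∧ closure (Loewner.hull W T) ⊆ {z : ℂ | 0 ≤ z.im} := by
  refine ⟨Metric.isCompact_of_isClosed_isBounded isClosed_closure
    (((Loewner.isBounded_closedHull hW T).subset (Loewner.hull_subset_closedHull W T)).closure), ?_⟩
  refine closure_minimal (fun z hz ↦ ?_) (isClosed_le continuous_const Complex.continuous_im)
  have hz' : 0 < z.im := Loewner.hull_subset W T hz
  exact hz'.le

/-- SLE side, the `5ε` estimate: with `d_H (range c, Φ γ[0,T]) ≤ 2ε` (tail),
`d_H (Φ γ[0,T], Φ (closure K_T(W'))) ≤ ε` (continuity at the driver `V`, `closure K_T(V) = γ[0,T]`)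
and `d_H (Φ (closure K_T(W')), K) ≤ 2ε`, the triangle inequality (all sets nonempty and bounded)
gives `d_H (range c, K) ≤ 5ε`. [folklore] -/
theorem exists_hausdorffDist_range_le {D : DobrushinDomain}
    (φ : ConformalEquiv upperHalfPlaneSet D.carrier) {V : ℝ≥0 → ℝ} {γ : ℝ≥0 → ℂ}
    (hγ : Continuous γ) (hγH : ∀ t, 0 ≤ (γ t).im) {T : ℝ≥0}
    (hhull : closure (Loewner.hull V T) = γ '' Icc 0 T) {ε : ℝ} (hε : 0 ≤ ε) {ρ : ℝ}
    (hcont : ∀ W' : ℝ≥0 → ℝ, Continuous W' → (∀ s : ℝ≥0, s ≤ T → |W' s - V s| ≤ ρ) →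
      hausdorffDist (φ.boundaryExtension '' closure (Loewner.hull W' T))
        (φ.boundaryExtension '' closure (Loewner.hull V T)) ≤ ε)
    {c : Curve ℂ} (hc : IsCompactifiedImage φ.boundaryExtension γ (D.pt 1) c)
    (htail : ∀ t : ℝ≥0, T ≤ t → dist (φ.boundaryExtension (γ t)) (D.pt 1) ≤ ε)
    {F : Set (NonemptyCompacts ℂ)}
    (hnear : ∃ W' : ℝ≥0 → ℝ, Continuous W' ∧ (∀ s : ℝ≥0, s ≤ T → |W' s - V s| ≤ ρ) ∧
      (Loewner.hull W' T).Nonempty ∧ ∃ K ∈ F,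
        hausdorffDist (φ.boundaryExtension '' closure (Loewner.hull W' T)) (K : Set ℂ) ≤ 2 * ε) :
    ∃ K ∈ F, hausdorffDist c.range (K : Set ℂ) ≤ 5 * ε := by
  obtain ⟨W', hW', hWV, hne, K, hKF, hK⟩ := hnear
  refine ⟨K, hKF, ?_⟩
  have h1 : hausdorffDist c.range (φ.boundaryExtension '' (γ '' Icc 0 T)) ≤ 2 * ε :=
    hausdorffDist_range_image_le hc hε htail
  have h2 : hausdorffDist (φ.boundaryExtension '' (γ '' Icc 0 T))
      (φ.boundaryExtension '' closure (Loewner.hull W' T)) ≤ ε := by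
    rw [hausdorffDist_comm, ← hhull]
    exact hcont W' hW' hWV
  have hAne : (φ.boundaryExtension '' (γ '' Icc 0 T)).Nonempty :=
    ⟨_, γ 0, ⟨0, ⟨le_rfl, zero_le⟩, rfl⟩, rfl⟩
  have hAb : Bornology.IsBounded (φ.boundaryExtension '' (γ '' Icc 0 T)) :=
    isBounded_image_boundaryExtension φ (isCompact_Icc.image hγ)
      (by rintro _ ⟨t, -, rfl⟩; exact hγH t)
  have hHne : (φ.boundaryExtension '' closure (Loewner.hull W' T)).Nonempty :=
    (hne.mono subset_closure).image _
  have hHb : Bornology.IsBounded (φ.boundaryExtension '' closure (Loewner.hull W' T)) :=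
    isBounded_image_boundaryExtension φ (isCompact_closure_hull hW' T).1
      (isCompact_closure_hull hW' T).2
  calc hausdorffDist c.range (K : Set ℂ)
      ≤ hausdorffDist c.range (φ.boundaryExtension '' (γ '' Icc 0 T)) +
          hausdorffDist (φ.boundaryExtension '' (γ '' Icc 0 T)) K :=
        hausdorffDist_triangle (hausdorffEDist_ne_top_of_nonempty_of_bounded c.range_nonempty
          hAne c.isCompact_range.isBounded hAb)
    _ ≤ hausdorffDist c.range (φ.boundaryExtension '' (γ '' Icc 0 T)) +
          (hausdorffDist (φ.boundaryExtension '' (γ '' Icc 0 T))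
              (φ.boundaryExtension '' closure (Loewner.hull W' T)) +
            hausdorffDist (φ.boundaryExtension '' closure (Loewner.hull W' T)) K) :=
        add_le_add le_rfl (hausdorffDist_triangle
          (hausdorffEDist_ne_top_of_nonempty_of_bounded hAne hHne hAb hHb))
    _ ≤ 2 * ε + (ε + 2 * ε) := add_le_add h1 (add_le_add h2 hK)
    _ = 5 * ε := by ring

/-- SLE side, deterministic core: if the restricted driver `V|[0,T]` lies in the closure of the bad
driver set `A₀` (restrictions of drivers `W'` with `K_T(W') ≠ ∅` and `φ̄ (closure K_T(W'))`
`2ε`-Hausdorff-close to some `K ∈ F`), the chain of `V` has `closure K_T(V) = γ[0,T]`, the map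
`W ↦ φ̄ (closure K_T(W))` is `ε`-continuous at `V` on a sup-ball of radius `ρ` on `[0,T]`, and the
tail `φ̄ (γ t)`, `t ≥ T`, stays within `ε` of `b`, then the range of the compactified image of `γ`
lies in the closed `5ε`-thickening of `F` in `NonemptyCompacts ℂ`. [folklore] -/
theorem mem_cthickening_of_mem_closure {D : DobrushinDomain}
    (φ : ConformalEquiv upperHalfPlaneSet D.carrier) {V : ℝ≥0 → ℝ} (hV : Continuous V)
    {γ : ℝ≥0 → ℂ} (hγ : Continuous γ) (hγH : ∀ t, 0 ≤ (γ t).im) {T : ℝ≥0}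
    (hhull : closure (Loewner.hull V T) = γ '' Icc 0 T) {ε ρ : ℝ} (hε : 0 ≤ ε) (hρ : 0 < ρ)
    (hcont : ∀ W' : ℝ≥0 → ℝ, Continuous W' → (∀ s : ℝ≥0, s ≤ T → |W' s - V s| ≤ ρ) →
      hausdorffDist (φ.boundaryExtension '' closure (Loewner.hull W' T))
        (φ.boundaryExtension '' closure (Loewner.hull V T)) ≤ ε)
    {c : Curve ℂ} (hc : IsCompactifiedImage φ.boundaryExtension γ (D.pt 1) c)
    (htail : ∀ t : ℝ≥0, T ≤ t → dist (φ.boundaryExtension (γ t)) (D.pt 1) ≤ ε)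
    {F : Set (NonemptyCompacts ℂ)} {A₀ : Set C(↥(Set.Icc (0:ℝ≥0) T), ℝ)}
    (hA₀ : ∀ w ∈ A₀, ∃ (W' : ℝ≥0 → ℝ) (hW' : Continuous W'),
      (⟨W', hW'⟩ : C(ℝ≥0, ℝ)).restrict (Set.Icc (0:ℝ≥0) T) = w ∧ (Loewner.hull W' T).Nonempty ∧
      ∃ K ∈ F, hausdorffDist (φ.boundaryExtension '' closure (Loewner.hull W' T)) (K : Set ℂ) ≤
        2 * ε)
    (hZ : (⟨V, hV⟩ : C(ℝ≥0, ℝ)).restrict (Set.Icc (0:ℝ≥0) T) ∈ closure A₀) :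
    (⟨⟨(CurveClass.mk c).range, (CurveClass.mk c).isCompact_range⟩,
      (CurveClass.mk c).range_nonempty⟩ : NonemptyCompacts ℂ) ∈ cthickening (5 * ε) F := by
  obtain ⟨w, hw, hdw⟩ := Metric.mem_closure_iff.1 hZ ρ hρ
  obtain ⟨W', hW', hW'w, hne, K, hKF, hK⟩ := hA₀ w hw
  have hnear : ∀ s : ℝ≥0, s ≤ T → |W' s - V s| ≤ ρ := by
    intro s hs
    have h := (ContinuousMap.dist_apply_le_dist (⟨s, ⟨zero_le, hs⟩⟩ : Set.Icc (0:ℝ≥0) T)).trans_lt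
      hdw
    rw [← hW'w, ContinuousMap.restrict_apply, ContinuousMap.restrict_apply, ContinuousMap.coe_mk,
      ContinuousMap.coe_mk, Real.dist_eq, abs_sub_comm] at h
    exact h.le
  obtain ⟨K', hK'F, hK'⟩ := exists_hausdorffDist_range_le φ hγ hγH hhull hε hcont hc htail
    ⟨W', hW', hnear, hne, K, hKF, hK⟩
  refine mem_cthickening_of_dist_le _ K' _ _ hK'F ?_
  rw [Metric.NonemptyCompacts.dist_eq]
  show hausdorffDist (CurveClass.mk c).range (K' : Set ℂ) ≤ 5 * ε
  rw [CurveClass.range_mk]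
  exact hK'

/-! ### The lattice side, deterministic core -/

/-- Lattice side, deterministic core: a simple curve `X` from `a` to `b`, interior in `D`, whose
class is describable through `φ`, which does NOT show the H7 window
`∃ s < t, |X s - b| ≤ r ∧ ε ≤ |X t - b|` (`r ≤ ε`), and a capacity `T ≥ T₀(r)`, `T > 0`: the
dictionary reads `φ̄ (closure K_T(W)) = X[0, u₀]` with an `r`-approach of `b` before `u₀`, hence
`X[u₀, 1] ⊆ B(b, ε)` and `d_H (φ̄ (closure K_T(W)), range X) ≤ 2ε` (and `K_T(W) ≠ ∅`), for the
driving function `W` of the class of `X`. [folklore] -/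
theorem lattice_hausdorffDist_le {D : DobrushinDomain}
    {φ : ConformalEquiv upperHalfPlaneSet D.carrier}
    (hLD1 : ∀ (X : Curve ℂ) (W : ℝ≥0 → ℝ), Function.Injective X → X.source = D.pt 0 →
      X.target = D.pt 1 → (∀ t : I, X t = D.pt 0 ∨ X t = D.pt 1 ∨ X t ∈ D.carrier) →
      IsLoewnerDescribed φ (CurveClass.mk X) W →
      Loewner.IsSimpleTrace (Loewner.trace W) ∧
      (∀ T : ℝ≥0, 0 < T → closure (Loewner.hull W T) = Loewner.trace W '' Set.Icc 0 T) ∧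
      (∀ T : ℝ≥0, ∃ u₀ : I, X u₀ = φ.boundaryExtension (Loewner.trace W T) ∧
        X '' Set.Icc 0 u₀ = φ.boundaryExtension '' (Loewner.trace W '' Set.Icc 0 T)))
    {r ε : ℝ} (hrε : r ≤ ε) {T₀ T : ℝ≥0} (hT₀T : T₀ ≤ T) (hT : 0 < T)
    (hT₀ : ∀ (W : ℝ≥0 → ℝ) (γ : ℝ≥0 → ℂ), Continuous W → Loewner.IsGeneratedByCurve W γ →
      ∀ T : ℝ≥0, T₀ ≤ T → ∃ t : ℝ≥0, t ≤ T ∧ dist (φ.boundaryExtension (γ t)) (D.pt 1) < r)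
    {X : Curve ℂ} (hX : Function.Injective X ∧ X.source = D.pt 0 ∧ X.target = D.pt 1 ∧
      ∀ t : I, X t = D.pt 0 ∨ X t = D.pt 1 ∨ X t ∈ D.carrier)
    (hdesc : IsLoewnerDescribable φ (CurveClass.mk X))
    (hnotail : ¬ ∃ s t : I, s < t ∧ dist (X s) (D.pt 1) ≤ r ∧ ε ≤ dist (X t) (D.pt 1)) :
    (Loewner.hull (drivingFunction φ (CurveClass.mk X)) T).Nonempty ∧
      hausdorffDist (φ.boundaryExtension ''
        closure (Loewner.hull (drivingFunction φ (CurveClass.mk X)) T)) X.range ≤ 2 * ε := by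
  have hW : IsLoewnerDescribed φ (CurveClass.mk X) (drivingFunction φ (CurveClass.mk X)) :=
    isLoewnerDescribed_drivingFunction hdesc
  obtain ⟨-, hhull, hu⟩ := hLD1 X _ hX.1 hX.2.1 hX.2.2.1 hX.2.2.2 hW
  have hgen := hW.exists_eq_mk_trace.1
  obtain ⟨u₀, -, himg⟩ := hu T
  obtain ⟨t, htT, hdist⟩ := hT₀ _ _ hW.continuous hgen T hT₀T
  have hmem : φ.boundaryExtension (Loewner.trace (drivingFunction φ (CurveClass.mk X)) t) ∈
      X '' Set.Icc 0 u₀ := by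
    rw [himg]
    exact ⟨_, ⟨t, ⟨zero_le, htT⟩, rfl⟩, rfl⟩
  obtain ⟨s, hs, hsX⟩ := hmem
  rw [← hsX] at hdist
  have hε : 0 ≤ ε := ((dist_nonneg.trans_lt hdist).le).trans hrε
  have hafter : ∀ t' : I, u₀ ≤ t' → dist (X t') (D.pt 1) < ε := by
    intro t' ht'
    rcases lt_or_eq_of_le (hs.2.trans ht') with hlt | heq
    · by_contra hge
      exact hnotail ⟨s, t', hlt, hdist.le, not_lt.1 hge⟩
    · rw [← heq]
      exact hdist.trans_le hrε
  refine ⟨Loewner.hull_nonempty hW.continuous hT, ?_⟩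
  rw [hhull T hT, ← himg]
  exact hausdorffDist_image_Icc_range_le X u₀ hε hafter

/-! ### Three measure-theoretic inputs -/

/-- Continuity of `r ↦ μ {f ∈ F_r}` at `r = 0` for a closed `F` and a finite measure
(`tendsto_measure_cthickening_of_isClosed` on the image measure): some `ε > 0` has
`μ {f ∈ F_{5ε}} ≤ μ {f ∈ F} + β`. [folklore] -/
theorem exists_measure_cthickening_le {α Ω : Type*} [PseudoMetricSpace α] [MeasurableSpace α]
    [OpensMeasurableSpace α] [MeasurableSpace Ω] {μ : Measure Ω} [IsFiniteMeasure μ] {f : Ω → α}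
    (hf : AEMeasurable f μ) {F : Set α} (hF : IsClosed F) {β : ℝ≥0∞} (hβ : β ≠ 0) :
    ∃ ε : ℝ, 0 < ε ∧ μ {ω | f ω ∈ cthickening (5 * ε) F} ≤ μ {ω | f ω ∈ F} + β := by
  have hν : ∀ s : Set α, MeasurableSet s → μ.map f s = μ {ω | f ω ∈ s} := fun s hs ↦
    Measure.map_apply_of_aemeasurable hf hs
  have ht := tendsto_measure_cthickening_of_isClosed (μ := μ.map f)
    ⟨1, one_pos, measure_ne_top _ _⟩ hF
  have hlt : μ.map f F < μ.map f F + β := ENNReal.lt_add_right (measure_ne_top _ _) hβ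
  obtain ⟨r, hr, hr0⟩ := (((ht.eventually_lt_const hlt).filter_mono nhdsWithin_le_nhds).and
    (self_mem_nhdsWithin (s := Ioi (0 : ℝ)) (a := 0))).exists
  refine ⟨r / 5, div_pos (mem_Ioi.1 hr0) (by norm_num), ?_⟩
  rw [show 5 * (r / 5) = r by ring, ← hν _ isClosed_cthickening.measurableSet,
    ← hν _ hF.measurableSet]
  exact hr.le

/-- The SLE tail: from the a.e. statement "`φ̄ (γ t) → b`" (transience clause of
`SLEHullPackage`), for every `ε > 0` and `β ≠ 0` some `N` has
`P' {∃ t ≥ N, ε < |φ̄ (γ t) - b|} ≤ β`. Measurability: the bad event is contained in the countable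
union over a dense set of times `q` with `N < q + 1` of `{ε < |φ̄ (γ q) - b|}` (the trace is continuous
and its marginals are measurable, `measurable_sleTrace`; `φ̄ ∘ liftIm 0` is continuous), a
decreasing family of measurable sets with null intersection. [folklore] -/
theorem exists_measure_tail_le {κ : ℝ≥0} {D : DobrushinDomain}
    (φ : ConformalEquiv upperHalfPlaneSet D.carrier)
    (hB : ∀ᵐ ω ∂Process.preWienerMeasure, ∀ ε : ℝ, 0 < ε → ∃ T₀ : ℝ≥0, ∀ t : ℝ≥0, T₀ ≤ t →
      dist (φ.boundaryExtension (sleTrace κ ω t)) (D.pt 1) ≤ ε)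
    {ε : ℝ} (hε : 0 < ε) {β : ℝ≥0∞} (hβ : β ≠ 0) :
    ∃ N : ℕ, Process.preWienerMeasure {ω | ∃ t : ℝ≥0, (N : ℝ≥0) ≤ t ∧
      ε < dist (φ.boundaryExtension (sleTrace κ ω t)) (D.pt 1)} ≤ β := by
  haveI : IsProbabilityMeasure Process.preWienerMeasure := isProbabilityMeasure_preWienerMeasure'
  have hΦc : Continuous fun z ↦ φ.boundaryExtension (Loewner.liftIm 0 z) :=
    continuous_boundaryExtension_liftIm φ
  have hfeq : ∀ (ω : ℝ≥0 → ℝ) (t : ℝ≥0),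
      dist (φ.boundaryExtension (Loewner.liftIm 0 (sleTrace κ ω t))) (D.pt 1) =
        dist (φ.boundaryExtension (sleTrace κ ω t)) (D.pt 1) := fun ω t ↦ by
    rw [Loewner.liftIm_of_le (x := sleTrace κ ω t) (Loewner.trace_im_nonneg (sleDriving κ ω) t)]
  have hfm : ∀ t : ℝ≥0, Measurable fun ω : ℝ≥0 → ℝ ↦
      dist (φ.boundaryExtension (Loewner.liftIm 0 (sleTrace κ ω t))) (D.pt 1) := fun t ↦
    (hΦc.measurable.comp (measurable_sleTrace κ t)).dist measurable_const
  have hfc : ∀ ω : ℝ≥0 → ℝ, Continuous fun t : ℝ≥0 ↦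
      dist (φ.boundaryExtension (Loewner.liftIm 0 (sleTrace κ ω t))) (D.pt 1) := fun ω ↦
    (hΦc.comp (continuous_sleTrace κ ω)).dist continuous_const
  obtain ⟨S, hSc, hSd⟩ := TopologicalSpace.exists_countable_dense ℝ≥0
  obtain ⟨B, hBmem⟩ : ∃ B : ℕ → Set (ℝ≥0 → ℝ), ∀ N ω, ω ∈ B N ↔ ∃ q ∈ S, (N : ℝ≥0) < q + 1 ∧
      ε < dist (φ.boundaryExtension (Loewner.liftIm 0 (sleTrace κ ω q))) (D.pt 1) :=
    ⟨fun N ↦ {ω | ∃ q ∈ S, (N : ℝ≥0) < q + 1 ∧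
      ε < dist (φ.boundaryExtension (Loewner.liftIm 0 (sleTrace κ ω q))) (D.pt 1)},
      fun _ _ ↦ Iff.rfl⟩
  have hBm : ∀ N, MeasurableSet (B N) := by
    intro N
    have hrep : B N = ⋃ q ∈ {q ∈ S | (N : ℝ≥0) < q + 1},
        {ω | ε < dist (φ.boundaryExtension (Loewner.liftIm 0 (sleTrace κ ω q))) (D.pt 1)} := by
      ext ω
      simp only [hBmem, mem_iUnion, mem_setOf_eq, exists_prop, and_assoc]
    rw [hrep]
    exact MeasurableSet.biUnion (hSc.mono (sep_subset _ _))
      fun q _ ↦ measurableSet_lt measurable_const (hfm q)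
  have hanti : Antitone B := fun N N' hNN' ω hω ↦ by
    obtain ⟨q, hqS, hq, hωq⟩ := (hBmem N' ω).1 hω
    exact (hBmem N ω).2 ⟨q, hqS, lt_of_le_of_lt (Nat.cast_le.2 hNN') hq, hωq⟩
  have hnull : Process.preWienerMeasure (⋂ N, B N) = 0 := by
    rw [measure_eq_zero_iff_ae_notMem]
    filter_upwards [hB] with ω hω hmem
    obtain ⟨T₀, hT₀⟩ := hω ε hε
    obtain ⟨N, hN⟩ := exists_nat_ge (T₀ + 1)
    obtain ⟨q, -, hq, hωq⟩ := (hBmem N ω).1 (mem_iInter.1 hmem N)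
    have hT₀q : T₀ ≤ q := le_of_lt (lt_of_add_lt_add_right (hN.trans_lt hq))
    have h := hT₀ q hT₀q
    rw [← hfeq] at h
    exact absurd h (not_le.2 hωq)
  have htend := tendsto_measure_iInter_atTop (μ := Process.preWienerMeasure)
    (fun N ↦ (hBm N).nullMeasurableSet) hanti ⟨0, measure_ne_top _ _⟩
  rw [hnull] at htend
  obtain ⟨N, hN⟩ := (htend.eventually_lt_const (pos_iff_ne_zero.2 hβ)).exists
  refine ⟨N, (measure_mono ?_).trans hN.le⟩
  rintro ω ⟨t, hNt, hωt⟩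
  have hopen : IsOpen {s : ℝ≥0 | (N : ℝ≥0) < s + 1 ∧
      ε < dist (φ.boundaryExtension (Loewner.liftIm 0 (sleTrace κ ω s))) (D.pt 1)} :=
    (isOpen_lt continuous_const (continuous_id.add continuous_const)).inter
      (isOpen_lt continuous_const (hfc ω))
  obtain ⟨q, hqS, hqN, hq⟩ := hSd.exists_mem_open hopen
    ⟨t, lt_of_le_of_lt hNt (lt_add_one t), by rwa [hfeq]⟩
  exact (hBmem N ω).2 ⟨q, hqS, hqN, hq⟩

/-- The junk driver `0` is not charged by the SLE law: `P' {√κ B_T = 0} = 0` for `κ > 0`, `T ≠ 0`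
(the law of `B_T` is `gaussianReal 0 T`, `Process.hasLaw_brownian_sub`, which has no atom).
[folklore] -/
theorem measure_sleDriving_apply_eq_zero (κ : ℝ≥0) (hκ : 0 < κ) {T : ℝ≥0} (hT : T ≠ 0) :
    Process.preWienerMeasure {ω | sleDriving κ ω T = 0} = 0 := by
  have hlaw := Process.hasLaw_brownian_sub exists_isBrownianReal_measurable_continuous_holds T 0
  have hsub : Process.brownian T - Process.brownian 0 = Process.brownian T := by
    rw [Process.brownian_zero, sub_zero]
  rw [hsub] at hlaw
  have hv : nndist T.1 (0 : ℝ≥0).1 ≠ 0 := by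
    rw [Ne, nndist_eq_zero]
    exact fun h ↦ hT (Subtype.ext h)
  have hsq : Real.sqrt κ ≠ 0 := (Real.sqrt_pos.2 (NNReal.coe_pos.2 hκ)).ne'
  have hset : {ω : ℝ≥0 → ℝ | sleDriving κ ω T = 0} = Process.brownian T ⁻¹' {0} := by
    ext ω
    simp only [mem_setOf_eq, mem_preimage, mem_singleton_iff, sleDriving_apply, mul_eq_zero, hsq,
      false_or]
  haveI : NullSingletonClass (ProbabilityTheory.gaussianReal (0 : ℝ) (nndist T.1 (0 : ℝ≥0).1)) :=
    ProbabilityTheory.nullSingletonClass_gaussianReal hv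
  rw [hset, ← Measure.map_apply (Process.measurable_brownian T) (measurableSet_singleton 0),
    hlaw.map_eq]
  exact measure_singleton 0

end PathUpgradeRRangeBound

end Summit.CriticalPhenomena.SAWScalingLimit.Theorems

end
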